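import Summits.Parity.GeneralizedHardyLittlewood.Theorems.GreenTaoLevelTwoMNTwoPropNineteenOfInverse

/-!
# Route `GreenTaoLevelTwo`, crux `MNTwo` (stmt-Parity-21276), line `birth`, stub `stub_mnVertical`:
# the trivial bound for the localized Möbius sum and the lower bound `ρ ≳ log^{-A} N` (GT 2008b §10)

Block H6 glue of the `stub_mnVertical` census (B. Green, T. Tao, *Quadratic uniformity of the
Möbius function*, Ann. Inst. Fourier 58 (2008) = arXiv:math/0606087, §10, eq. (r-big): "Since `ψ`
is Lipschitz and supported on `B(n₀,ρ₀)`, we have `‖ψ‖_∞ ≪ ρ₀`, and so we conclude from (fphi-2)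
that `ρ₀ ≳ 1`").  In the tree's large-`N` inverse statement `hInvL`
(`…MNTwoVerticalOfInverseLargeN`) the weight `ψ` is nonnegative, `ν`-Lipschitz and supported in
the Bohr ball `B(n₀,ρ)`, hence `ψ ≤ 3/2` (`…MNTwoPropNineteenOfInverse.weight_le_three_halves`) and
supported on `≤ 2ρN + 1` integers; so the localized sum is at most `(3/2)(2ρN+1)` and a large sum
`≥ N/log^A N` forces `ρ ≥ P⁻¹` for any `P` with `6 log^A N ≤ P ≤ N` — the hypothesis `P⁻¹ ≤ ρ` of
`…MNTwoMajorArcOfPropTwentyTwo.majorArc_of_prop22`.  Def-free.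

* `card_support_le` — `#{n ∈ (N,2N] : ψ n ≠ 0} ≤ 2ρN + 1`;
* `norm_localized_sum_le` — `‖Σ_{N<n≤2N} μ(n)ψ(n)e(−φ(n))‖ ≤ (3/2)(2ρN + 1)` (the lower bound
  on `ρ` from a large sum is then one line of arithmetic for the assembler).

References: [GreenTao2008QuadraticMobius] arXiv:math/0606087 §10, (r-big).
-/

noncomputable section

open Finset Real ArithmeticFunction
open scoped ArithmeticFunction.Moebius FourierTransform

namespace Summit.Parity.GeneralizedHardyLittlewood.GreenTaoLevelTwoMNTwoRhoLowerBound

open Summit.Parity.GeneralizedHardyLittlewood.GreenTaoLevelTwoMNTwoPropNineteenOfInverse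
  (weight_le_three_halves)

variable {k : ℕ}

/-- The support of a weight localized to `|n − n₀| < ρN` inside `(N, 2N]` has at most `2ρN + 1`
elements. [folklore] -/
theorem card_support_le (α : Fin k → ℝ) (N : ℕ) (n₀ : ℤ) {ρ : ℝ} (hρ : 0 ≤ ρ) (ψ : ℤ → ℝ)
    (hsupp : ∀ n, ψ n ≠ 0 →
      (∀ i, ‖((((n - n₀ : ℤ) : ℝ) * α i : ℝ) : AddCircle (1 : ℝ))‖ +
          |((n - n₀ : ℤ) : ℝ)| / N < ρ) ∧ |((n - n₀ : ℤ) : ℝ)| / N < ρ) :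
    (#((Ioc (N : ℤ) (2 * N)).filter fun n => ψ n ≠ 0) : ℝ) ≤ 2 * ρ * N + 1 := by
  classical
  set F : ℤ := ⌊ρ * N⌋ with hF
  have hF0 : 0 ≤ F := by rw [hF]; exact Int.floor_nonneg.2 (by positivity)
  have hsub : ((Ioc (N : ℤ) (2 * N)).filter fun n => ψ n ≠ 0) ⊆ Icc (n₀ - F) (n₀ + F) := by
    intro n hn
    rw [mem_filter] at hn
    have h := (hsupp n hn.2).2
    rw [mem_Icc]
    have hNr : (0 : ℝ) ≤ N := Nat.cast_nonneg N
    have habs : |((n - n₀ : ℤ) : ℝ)| ≤ ρ * N := by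
      rcases Nat.eq_zero_or_pos N with h0 | hpos
      · -- `N = 0`: the interval `(0, 0]` is empty, so this case is vacuous
        exfalso
        have := hn.1; rw [mem_Ioc, h0] at this; push_cast at this; omega
      · have hNpos : (0 : ℝ) < N := by exact_mod_cast hpos
        rw [div_lt_iff₀ hNpos] at h
        exact h.le
    have habs' : |(n : ℝ) - n₀| ≤ ρ * N := by push_cast at habs; exact habs
    rw [abs_le] at habs'
    have hfl := Int.lt_floor_add_one (ρ * N)
    rw [← hF] at hfl
    have h1' : n - n₀ ≤ F := by
      by_contra hc
      push Not at hc
      have : (F : ℝ) + 1 ≤ (n : ℝ) - n₀ := by exact_mod_cast (show F + 1 ≤ n - n₀ by omega)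
      linarith [habs'.2]
    have h2' : -F ≤ n - n₀ := by
      by_contra hc
      push Not at hc
      have : (n : ℝ) - n₀ ≤ -(F : ℝ) - 1 := by exact_mod_cast (show n - n₀ ≤ -F - 1 by omega)
      linarith [habs'.1]
    constructor <;> omega
  have hcard := card_le_card hsub
  rw [Int.card_Icc] at hcard
  have e : ((n₀ + F + 1 - (n₀ - F)).toNat : ℝ) = 2 * F + 1 := by
    have h0 : 0 ≤ n₀ + F + 1 - (n₀ - F) := by omega
    have : ((n₀ + F + 1 - (n₀ - F)).toNat : ℤ) = n₀ + F + 1 - (n₀ - F) := Int.toNat_of_nonneg h0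
    have : (((n₀ + F + 1 - (n₀ - F)).toNat : ℤ) : ℝ) = ((n₀ + F + 1 - (n₀ - F) : ℤ) : ℝ) := by
      exact_mod_cast this
    push_cast at this
    have e2 : (((n₀ + F + 1 - (n₀ - F)).toNat : ℤ) : ℝ) = ((n₀ + F + 1 - (n₀ - F)).toNat : ℝ) := by
      norm_cast
    linarith [e2]
  have hFle : (F : ℝ) ≤ ρ * N := Int.floor_le _
  calc (#((Ioc (N : ℤ) (2 * N)).filter fun n => ψ n ≠ 0) : ℝ)
      ≤ ((n₀ + F + 1 - (n₀ - F)).toNat : ℝ) := by exact_mod_cast hcard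
    _ = 2 * F + 1 := e
    _ ≤ 2 * ρ * N + 1 := by linarith

/-- **Trivial bound for the localized Möbius sum.**  For a nonnegative weight `ψ` supported in
the Bohr ball `B(n₀,ρ)` (`2ρ < 1`) and `ν`-Lipschitz, `‖Σ_{N<n≤2N} μ(n)ψ(n)e(−φ(n))‖ ≤ (3/2)(2ρN+1)`.
[cite: GreenTao2008QuadraticMobius, §10, (r-big)] -/
theorem norm_localized_sum_le (α : Fin k → ℝ) {N : ℕ} (hN : 1 ≤ N) (n₀ : ℤ) {ρ : ℝ}
    (hρ0 : 0 ≤ ρ) (hρ : 2 * ρ < 1) (ψ : ℤ → ℝ) (hψ0 : ∀ n, 0 ≤ ψ n)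
    (hsupp : ∀ n, ψ n ≠ 0 →
      (∀ i, ‖((((n - n₀ : ℤ) : ℝ) * α i : ℝ) : AddCircle (1 : ℝ))‖ +
          |((n - n₀ : ℤ) : ℝ)| / N < ρ) ∧ |((n - n₀ : ℤ) : ℝ)| / N < ρ)
    (hlip : ∀ (n n' : ℤ) (t : ℝ), 0 ≤ t →
      (∀ i, ‖((((n - n' : ℤ) : ℝ) * α i : ℝ) : AddCircle (1 : ℝ))‖ ≤ t) →
        |ψ n - ψ n'| ≤ t + |((n - n' : ℤ) : ℝ)| / N)
    (φ : ℤ → ℝ) :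
    ‖∑ n ∈ Ioc (N : ℕ) (2 * N), ((μ n : ℝ) : ℂ) * ((ψ n : ℝ) : ℂ) * (𝐞 (-(φ n)) : ℂ)‖ ≤
      3 / 2 * (2 * ρ * N + 1) := by
  classical
  have hψ32 : ∀ n, ψ n ≤ 3 / 2 := weight_le_three_halves α hN n₀ hρ ψ hψ0 hsupp hlip
  calc ‖∑ n ∈ Ioc (N : ℕ) (2 * N), ((μ n : ℝ) : ℂ) * ((ψ n : ℝ) : ℂ) * (𝐞 (-(φ n)) : ℂ)‖
      ≤ ∑ n ∈ Ioc (N : ℕ) (2 * N), ‖((μ n : ℝ) : ℂ) * ((ψ n : ℝ) : ℂ) * (𝐞 (-(φ n)) : ℂ)‖ :=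
        norm_sum_le _ _
    _ ≤ ∑ n ∈ Ioc (N : ℕ) (2 * N), ψ n := Finset.sum_le_sum fun n _ => by
        rw [norm_mul, norm_mul, Circle.norm_coe, mul_one, Complex.norm_real, Complex.norm_real,
          Real.norm_eq_abs, Real.norm_eq_abs, abs_of_nonneg (hψ0 n)]
        have h1 : |((μ n : ℝ))| ≤ 1 := by exact_mod_cast abs_moebius_le_one
        have := hψ0 n
        nlinarith [abs_nonneg ((μ n : ℝ))]
    _ = ∑ n ∈ (Ioc (N : ℤ) (2 * N)), ψ n := by
        have hmap : (Ioc N (2 * N)).map Nat.castEmbedding = Ioc (N : ℤ) (2 * N) := by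
          ext x
          simp only [Finset.mem_map, Finset.mem_Ioc, Nat.castEmbedding_apply]
          constructor
          · rintro ⟨m, ⟨h1, h2⟩, rfl⟩
            exact ⟨by exact_mod_cast h1, by exact_mod_cast h2⟩
          · rintro ⟨h1, h2⟩
            exact ⟨x.toNat, ⟨by omega, by omega⟩, Int.toNat_of_nonneg (by omega)⟩
        rw [← hmap, Finset.sum_map]
        simp only [Nat.castEmbedding_apply]
    _ = ∑ n ∈ (Ioc (N : ℤ) (2 * N)).filter (fun n => ψ n ≠ 0), ψ n :=
        (Finset.sum_filter_ne_zero _).symm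
    _ ≤ ∑ _n ∈ (Ioc (N : ℤ) (2 * N)).filter (fun n => ψ n ≠ 0), (3 / 2 : ℝ) :=
        Finset.sum_le_sum fun n _ => hψ32 n
    _ = 3 / 2 * #((Ioc (N : ℤ) (2 * N)).filter fun n => ψ n ≠ 0) := by
        rw [Finset.sum_const, nsmul_eq_mul, mul_comm]
    _ ≤ 3 / 2 * (2 * ρ * N + 1) := by
        have := card_support_le α N n₀ hρ0 ψ hsupp
        nlinarith

end Summit.Parity.GeneralizedHardyLittlewood.GreenTaoLevelTwoMNTwoRhoLowerBound
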